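import Literature.AlgebraicGeometry.Frobenioids.PadicKummerDualityIsoLocalField
import Literature.AlgebraicGeometry.Frobenioids.PadicKummerContextConj
import HarnessLib

/-!
# Frobenioids II, Def. 2.2 (ii) p. 18: the cup-product duality isomorphism is "independent of the
# choice of `H ↠ H_A` among its `G`-conjugates" and "compatible with the natural actions of `G_A/H_A`"

Mochizuki, *The geometry of Frobenioids II*, Kyushu J. Math. **62** (2008) 401–460, §2, Definition 2.2
(ii) p. 18 [cite: MochizukiFrdII2008, Def 2.2 (ii) p.18]: "… hence [in light of the condition of
Definition 2.2, (ii), (c)] an isomorphism [induced by the cup product on group cohomology]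
`H¹(H_A, μ_N(A)) ⥲ H_A^ab ⊗ F_N(A)` which is independent of the choice of the homomorphism `H ↠ H_A`
among its various `G`-conjugates and compatible with the natural actions of `G_A/H_A` on its domain
and codomain."

These two printed clauses were deliberately left untyped by the typer of Definition 2.2
(`PadicKummerSetting.lean`, module header "Deliberately NOT here") while the duality isomorphism was a
DATUM. For the CONSTRUCTED isomorphism (`Def22Context.dualityIsoOfBijective`, abc-iut-L2-t12's
cup-product construction) both are instances of its naturality "(γ₁)"
(`Iso.recTargetMap_dualityIsoOfBijective`) along two context isomorphisms:
* `Def22Context.Iso.toConjOuter X g α hα : X.Iso (X.conjOuter g)` (CONSTRUCTED here) — the identity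
  of `G`, conjugation by `outer g` on `Aut_E(A_E)`, the action of `outer g` on `O^□(A)` and conjugation
  by a lift `α ∈ Aut_C(A)` — from the context `X` (surjection `q : H ↠ H_A`) to abc-iut-L1-t7's context
  `X.conjOuter g` with THE OTHER CHOICE `γ q γ⁻¹ : H ↠ γ H_A γ⁻¹` of the homomorphism among its
  `G`-conjugates (`γ = outer g`); "(γ₁)" along it is the INDEPENDENCE clause
  (`recTargetMap_dualityIso_toConjOuter`): the cup-product isomorphisms for the two choices correspond
  under the canonical identifications of their domains and codomains;
* abc-iut-L1-d4's `Def22Context.Iso.conj X g α hα : X.Iso X` (the natural action of `g ∈ G`) — "(γ₁)"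
  along it is the EQUIVARIANCE clause (`recTargetMap_dualityIso_conj`): `ι (g · c) = g · ι (c)` for the
  actions of `g` on `H¹(H_A, μ_N(A))` and on `H_A^ab ⊗ F_N(A)` transported by the context automorphism
  (these actions factor through `G ↠ G_A`, and `H_A` acts trivially — abc-iut-L1-t7/L1-d4's
  `Rmk241Indeterminacy`, not re-proved here).
At the Galois binding `ofGaloisQuot` (hence `ofLocalField`) every `g ∈ G_K` has the lift `resGal L g`
(`Iso.conjOfGaloisQuot`), so both clauses hold there for every `g`. Bijectivity inputs are explicit at
the level of an arbitrary context and discharged at `ofLocalField` for the equivariance clause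
(`recTargetMap_dualityIsoOfLocalField_conj`). Proof-side companion; the one definition is the context
isomorphism `toConjOuter`. Nothing here concerns [IUTchIII]; classical.
-/

noncomputable section

namespace Literature.AlgebraicGeometry.Frobenioids

namespace PadicKummer

namespace Def22Context

open Kummer

namespace Iso

variable (X : Def22Context) (g : X.G) (α : X.AutC) (hα : X.res α = X.outer g)

/-- **The context isomorphism realising "another choice of `H ↠ H_A` among its `G`-conjugates"**
(Def. 2.2 (i) p. 17: "`G ↠ G_A` is only determined up to composition with an inner automorphism";
(ii) p. 18): from `X` to `X.conjOuter g` (same `G`, `H`, `O^□(A)`, `Aut_E(A_E)`; outer homomorphism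
composed with conjugation by `γ = outer g`), given by the IDENTITY of `G`, conjugation by `γ` on
`Aut_E(A_E)`, the action of `γ` on `O^□(A)` and conjugation by a lift `α ∈ Aut_C(A)` of `γ`.
[cite: MochizukiFrdII2008, Def 2.2 (ii) p.18] -/
def toConjOuter : X.Iso (X.conjOuter g) where
  isoC := MulAut.conj α
  isoO := MulDistribMulAction.toMulEquiv X.O (X.outer g)
  isoE := MulAut.conj (X.outer g)
  isoG := ContinuousMulEquiv.refl X.G
  res_isoC a := by
    change X.res (α * a * α⁻¹) = X.outer g * X.res a * (X.outer g)⁻¹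
    rw [map_mul, map_mul, map_inv, hα]
  isoO_smul τ x := by
    change X.outer g • (τ • x) = (X.outer g * τ * (X.outer g)⁻¹) • (X.outer g • x)
    rw [smul_smul, smul_smul, inv_mul_cancel_right]
  outer_isoG x := rfl
  map_H := by
    change Subgroup.map (MonoidHom.id X.G) X.H = X.H
    exact Subgroup.map_id X.H
  isGalois_iff := Iff.rfl

/-- `(toConjOuter X g α hα).isoG` is the identity of `G`. [cite: MochizukiFrdII2008, Def 2.2 (ii) p.18] -/
@[simp] theorem toConjOuter_isoG_apply (x : X.G) : (toConjOuter X g α hα).isoG x = x := rfl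

/-- `(toConjOuter X g α hα).isoO` is the action of `outer g`. [cite: MochizukiFrdII2008, Def 2.2 (ii) p.18] -/
@[simp] theorem toConjOuter_isoO_apply (x : X.O) : (toConjOuter X g α hα).isoO x = X.outer g • x := rfl

/-- `(toConjOuter X g α hα).isoE` is conjugation by `outer g`. [cite: MochizukiFrdII2008, Def 2.2 (ii) p.18] -/
@[simp] theorem toConjOuter_isoE_apply (τ : X.AutE) :
    (toConjOuter X g α hα).isoE τ = X.outer g * τ * (X.outer g)⁻¹ := rfl

/-- On `H_A`, `toConjOuter` is conjugation by `outer g` onto `γ H_A γ⁻¹ = (X.conjOuter g).HA`.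
[cite: MochizukiFrdII2008, Def 2.2 (ii) p.18] -/
theorem coe_toConjOuter_isoHA (k : X.HA) :
    (((toConjOuter X g α hα).isoHA k : (X.conjOuter g).HA) : (X.conjOuter g).AutE) =
      (X.outer g * k * (X.outer g)⁻¹ : X.AutE) := by
  rw [coe_isoHA]; rfl

variable (N : ℕ)

/-- **"independent of the choice of the homomorphism `H ↠ H_A` among its various `G`-conjugates"**
(Def. 2.2 (ii) p. 18), for the cup-product duality isomorphisms: the isomorphisms
`ι : H¹(H_A, μ_N(A)) ⥲ H_A^ab ⊗ F_N(A)` of `X` (choice `q : H ↠ H_A`) and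
`ι′ : H¹(γH_Aγ⁻¹, μ_N(A)) ⥲ (γH_Aγ⁻¹)^ab ⊗ F′_N(A)` of `X.conjOuter g` (choice `γ q γ⁻¹`) correspond under
the canonical identifications of domains (`isoH1`) and codomains (`isoHA^ab ⊗ isoFN`) induced by
conjugation by `γ = outer g`: `(isoHA^ab ⊗ isoFN) ∘ ι = ι′ ∘ isoH1`. Bijectivity inputs for both choices
are explicit. [cite: MochizukiFrdII2008, Def 2.2 (ii) p.18] -/
theorem recTargetMap_dualityIso_toConjOuter
    (hθ : Function.Bijective (thetaHomOf X N)) (hcup : Function.Bijective (cupDualOf X N))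
    (hθ' : Function.Bijective (thetaHomOf (X.conjOuter g) N))
    (hcup' : Function.Bijective (cupDualOf (X.conjOuter g) N))
    (c : groupCohomology.H1 (Rep.ofMulDistribMulAction X.HA (Mu N X.O))) :
    ((toConjOuter X g α hα).thm24Data N).recTargetMap
        (dualityApply X N (dualityIsoOfBijective X N hθ hcup) c) =
      dualityApply (X.conjOuter g) N (dualityIsoOfBijective (X.conjOuter g) N hθ' hcup')
        ((toConjOuter X g α hα).isoH1 N c) :=
  (toConjOuter X g α hα).recTargetMap_dualityIsoOfBijective N hθ hcup hθ' hcup' c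

/-- **"compatible with the natural actions of `G_A/H_A` on its domain and codomain"** (Def. 2.2 (ii)
p. 18), for the cup-product duality isomorphism `ι` of `X`: along the context automorphism
`Iso.conj X g α hα` of abc-iut-L1-d4 (the natural action of `g ∈ G`), `ι` intertwines the induced
action on `H¹(H_A, μ_N(A))` (`isoH1`) with the induced action on `H_A^ab ⊗ F_N(A)`
(`isoHA^ab ⊗ isoFN`): `(g·) ∘ ι = ι ∘ (g·)`. (The actions factor through `G ↠ G_A`; `H_A` acts
trivially — Rmk. 2.4.1.) [cite: MochizukiFrdII2008, Def 2.2 (ii) p.18] -/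
theorem recTargetMap_dualityIso_conj
    (hθ : Function.Bijective (thetaHomOf X N)) (hcup : Function.Bijective (cupDualOf X N))
    (c : groupCohomology.H1 (Rep.ofMulDistribMulAction X.HA (Mu N X.O))) :
    ((conj X g α hα).thm24Data N).recTargetMap (dualityApply X N (dualityIsoOfBijective X N hθ hcup) c) =
      dualityApply X N (dualityIsoOfBijective X N hθ hcup) ((conj X g α hα).isoH1 N c) :=
  (conj X g α hα).recTargetMap_dualityIsoOfBijective N hθ hcup hθ hcup c

end Iso

/-! ### At the arithmetic binding `ofLocalField`: every `g ∈ G_K` acts (lift `resGal L g`) -/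

section LocalField

open Field IntermediateField
open Literature.NumberTheory.GaloisRepresentations

variable {K : Type} [Field K] [ValuativeRel K] [TopologicalSpace K] [IsNonarchimedeanLocalField K]
  [CharZero K] (L : IntermediateField K (AlgebraicClosure K)) [Normal K L] [FiniteDimensional K L]
  (H : Subgroup (absoluteGaloisGroup K)) [H.Normal] (hH : IsOpen (H : Set (absoluteGaloisGroup K)))
  (S : StableSubmonoid L) (N : ℕ) [NeZero N]

/-- **Equivariance of the constructed duality isomorphism at the arithmetic binding, NO residual
input**: for every `g ∈ G_K`, the duality isomorphism `dualityIsoOfLocalField L H hH S N hS h` of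
`ofLocalField L H hH S` (an `(N, H)`-saturated `A` with `O^□_L ∋` the roots of unity) intertwines the
action of `g` on `H¹(H_A, μ_N(A))` with its action on `H_A^ab ⊗ F_N(A)`, the action being abc-iut-L1-d4's
context automorphism `Iso.conjOfGaloisQuot` (lift `resGal L g` of `outer g`).
[cite: MochizukiFrdII2008, Def 2.2 (ii) p.18] -/
theorem recTargetMap_dualityIsoOfLocalField_conj (g : absoluteGaloisGroup K)
    (hS : ∀ x : L, x ^ N = 1 → x ∈ S.toSubmonoid) (h : IsNHSaturated (ofLocalField L H hH S) N)
    (c : groupCohomology.H1 (Rep.ofMulDistribMulAction (ofLocalField L H hH S).HA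
      (Mu N (ofLocalField L H hH S).O))) :
    ((Iso.conjOfGaloisQuot L H hH (GalMonoid S) g).thm24Data N).recTargetMap
        (dualityApply _ N (dualityIsoOfLocalField L H hH S N hS h) c) =
      dualityApply _ N (dualityIsoOfLocalField L H hH S N hS h)
        ((Iso.conjOfGaloisQuot L H hH (GalMonoid S) g).isoH1 N c) :=
  (Iso.conjOfGaloisQuot L H hH (GalMonoid S) g).recTargetMap_dualityIsoOfBijective N _ _ _ _ c

/-- **Independence of the choice of `H ↠ H_A` at the arithmetic binding** (the clause of Def. 2.2 (ii)
p. 18), for `g ∈ G_K` and the cup-product isomorphisms of `ofLocalField L H hH S` and of its conjugate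
context `(ofLocalField L H hH S).conjOuter g`, given the bijectivity inputs of the conjugate context.
[cite: MochizukiFrdII2008, Def 2.2 (ii) p.18] -/
theorem recTargetMap_dualityIsoOfLocalField_toConjOuter (g : absoluteGaloisGroup K)
    (hS : ∀ x : L, x ^ N = 1 → x ∈ S.toSubmonoid) (h : IsNHSaturated (ofLocalField L H hH S) N)
    (hθ' : Function.Bijective (thetaHomOf ((ofLocalField L H hH S).conjOuter g) N))
    (hcup' : Function.Bijective (cupDualOf ((ofLocalField L H hH S).conjOuter g) N))
    (c : groupCohomology.H1 (Rep.ofMulDistribMulAction (ofLocalField L H hH S).HA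
      (Mu N (ofLocalField L H hH S).O))) :
    ((Iso.toConjOuter (ofLocalField L H hH S) g (resGal L g) rfl).thm24Data N).recTargetMap
        (dualityApply _ N (dualityIsoOfLocalField L H hH S N hS h) c) =
      dualityApply _ N (dualityIsoOfBijective _ N hθ' hcup')
        ((Iso.toConjOuter (ofLocalField L H hH S) g (resGal L g) rfl).isoH1 N c) :=
  (Iso.toConjOuter (ofLocalField L H hH S) g (resGal L g) rfl).recTargetMap_dualityIsoOfBijective
    N _ _ hθ' hcup' c

end LocalField

end Def22Context

end PadicKummer

end Literature.AlgebraicGeometry.Frobenioids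

end
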